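import Summits.Parity.GeneralizedHardyLittlewood.Theorems.BeyondDiagonalBeatsQuarter.OffDiagCleanScales
import HarnessLib

/-!
# Route `PrimeLevelFamEdge`, crux K_B (stmt-Parity-20343), line `diagonal_kernel_split` rev 4 — the entry point of the
# ALTERNATIVE last mile Ω″ (crux idea `l20-sign-blind-class-selection`, OMEGA-BLUEPRINT §3a «Entry twin
# `offDiag_io_of_subfamily_io`»): **a bound for the mollified off-diagonal over ANY non-empty sub-family of the good
# primes of a block, beyond every threshold ⇒ `stub_offDiagBelowSlack_io` verbatim**

`OffDiagCleanScales` (p634449) lands plan Ω's entry: a BLOCK bound `Σ_{q ∈ goodPrimes Δ′ N} offDiagMollified Δ′ q ≤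
U·Σ_q mainScaleReal Δ′ q` at clean scales ⇒ OFF_io,U (`offDiag_io_of_block_io`, `offDiagBelowSlack_io_of_blockAtCleanScales*`).
The alternative last mile Ω″ (idea card `Cruxes/BeyondDiagonalBeatsQuarter/Ideas/l20-sign-blind-class-selection.md`, seat
ls-idea-lens-20; sketch `Sketch_L20i_ClassSelectionOff.lean` sha16 80686a3309bd9614, farm rc 0) never bounds a full unclean
block: at an unclean scale it splits the good primes by the value `χ̃_N(q) = ±1` of the Landau–Page character and bounds the
BETTER HALF. Its kernel entry is therefore the same pigeonhole with the block replaced by an arbitrary non-empty sub-family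
`S ⊆ goodPrimes Δ′ N` chosen per scale — this file lands it against the tree's `PeterssonSplit.offDiagMollified`
(the sketch had to re-declare the object; here nothing is re-declared):

* **`offDiag_io_of_subfamily_io`** — `∀ N₁ ∃ N ≥ N₁ ∃ S ⊆ goodPrimes Δ′ N, S ≠ ∅, Σ_S offDiagMollified ≤ U·Σ_S ms` ⇒ the
  pointwise OFF control beyond every threshold (the `∀ q₀ ∃ q …` clause of the stub);
* `offDiag_io_of_filter_io` — the same for sub-families cut out by a per-scale predicate (a residue class, a character
  value `χ̃_N(q) = ε_N`, …);
* **`offDiagBelowSlack_io_of_subfamilyBound`** — with the window quantifiers: conclusion = `stub_offDiagBelowSlack_io`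
  VERBATIM (adapted from the sketch's `stubOff_of_classBlockBound`);
* `exists_half_sum_le` — better-of-two-halves bookkeeping: if a finite family splits as `S = S.filter p ⊔ S.filter ¬p` and
  `Σ_S f ≤ U·Σ_S g`, one of the two parts already satisfies `Σ f ≤ U·Σ g` (so a half bound is never weaker than a block
  bound as an input to the entry); `min_add_le_max_of_antisymm` — the card's «relativity» kernel
  `min (e + s₊) (−e + s₋) ≤ max s₊ s₋`, whatever the sign and size of `e`.

Pure logic / order bookkeeping; the sub-family bound is displayed as the hypothesis (OPEN — Ω″'s analytic statement (S-DH)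
and the dispersion heart are untouched). Standard axioms. Helper toward `stub_offDiagBelowSlack_io`; closes nothing.
«The programme SEARCHES and TYPES; no claim about Landau–Siegel zeros, Theorems 1–2 of arXiv:2211.02515 or
a repaired Margin232 until a kernel theorem says so.»
-/

noncomputable section

open Finset Polynomial
open scoped Real

namespace Summit.Parity.GeneralizedHardyLittlewood.Theorems.BeyondDiagonalBeatsQuarter.PeterssonSplit

open Literature.NumberTheory.LFunctions Literature.NumberTheory.LFunctions.KMV2000

/-! ### Sub-family control i.o. ⇒ pointwise control i.o. -/

/-- **Selected-sub-family control infinitely often ⇒ pointwise OFF control infinitely often.** `offDiag_io_of_block_io`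
with the full block of good primes replaced by any non-empty sub-family, chosen per scale (a sum `≤` a sum over a
non-empty family has a good term, `Finset.exists_le_of_sum_le`). Adapted from seat ls-idea-lens-20's sketch
`Sketch_L20i_ClassSelectionOff.offDiag_io_of_subfamily_io`. [cite: KowalskiMichelVanderKam2000, §2 p. 7 (M ∉ ℤ), §6 p. 19 — derivation] -/
theorem offDiag_io_of_subfamily_io {Δ' U : ℝ}
    (h : ∀ N₁ : ℕ, ∃ N : ℕ, N₁ ≤ N ∧ ∃ S : Finset ℕ, S ⊆ goodPrimes Δ' N ∧ S.Nonempty ∧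
      ∑ q ∈ S, offDiagMollified Δ' q ≤ U * ∑ q ∈ S, mainScaleReal Δ' q) :
    ∀ q₀ : ℕ, ∃ q : ℕ, ∃ _ : NeZero q, q₀ ≤ q ∧ q.Prime ∧
      (∀ n : ℕ, (n : ℝ) ≠ qhat q ^ Δ') ∧
        -(∑ l ∈ Icc 1 ⌊qhat q ^ Δ'⌋₊, ∑ m ∈ Icc 1 ⌊qhat q ^ Δ'⌋₊,
            ((mollifierCoeff (X ^ 2) (qhat q ^ Δ') l * mollifierCoeff (X ^ 2) (qhat q ^ Δ') m : ℝ) : ℂ) *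
              offDiag q l m).re ≤ U * mainScaleReal Δ' q := by
  intro q₀
  obtain ⟨N, hNq₀, S, hS, hSne, hsum⟩ := h q₀
  rw [Finset.mul_sum] at hsum
  obtain ⟨q, hqS, hqle⟩ := Finset.exists_le_of_sum_le hSne hsum
  obtain ⟨hqN, -, hqp, hqg⟩ := mem_goodPrimes_iff.mp (hS hqS)
  haveI : NeZero q := ⟨hqp.ne_zero⟩
  refine ⟨q, inferInstance, by omega, hqp, fun n ↦ by simpa [qhat] using hqg n, ?_⟩
  rwa [offDiagMollified_eq] at hqle

/-- **Sub-families cut out by a per-scale predicate** (a residue class, the value of a character at `q`, …): if beyond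
every threshold some scale `N` and predicate `P` give a non-empty family `{q ∈ goodPrimes Δ′ N : P q}` on which
`Σ offDiagMollified ≤ U·Σ ms`, the pointwise OFF control holds infinitely often. [cite: KowalskiMichelVanderKam2000, §6 p. 19 — derivation] -/
theorem offDiag_io_of_filter_io {Δ' U : ℝ}
    (h : ∀ N₁ : ℕ, ∃ N : ℕ, N₁ ≤ N ∧ ∃ P : ℕ → Prop, ∃ _ : DecidablePred P,
      ((goodPrimes Δ' N).filter P).Nonempty ∧
        ∑ q ∈ (goodPrimes Δ' N).filter P, offDiagMollified Δ' q ≤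
          U * ∑ q ∈ (goodPrimes Δ' N).filter P, mainScaleReal Δ' q) :
    ∀ q₀ : ℕ, ∃ q : ℕ, ∃ _ : NeZero q, q₀ ≤ q ∧ q.Prime ∧
      (∀ n : ℕ, (n : ℝ) ≠ qhat q ^ Δ') ∧
        -(∑ l ∈ Icc 1 ⌊qhat q ^ Δ'⌋₊, ∑ m ∈ Icc 1 ⌊qhat q ^ Δ'⌋₊,
            ((mollifierCoeff (X ^ 2) (qhat q ^ Δ') l * mollifierCoeff (X ^ 2) (qhat q ^ Δ') m : ℝ) : ℂ) *
              offDiag q l m).re ≤ U * mainScaleReal Δ' q := by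
  apply offDiag_io_of_subfamily_io
  intro N₁
  obtain ⟨N, hN, P, _, hne, hbd⟩ := h N₁
  exact ⟨N, hN, _, Finset.filter_subset _ _, hne, hbd⟩

/-- A block bound is a sub-family bound (`S =` the whole block): Ω's clean-scale input is an admissible input of the
sub-family entry. [cite: KowalskiMichelVanderKam2000, §6 p. 19 — derivation] -/
theorem subfamily_io_of_block_io {Δ' U : ℝ}
    (h : ∀ N₀ : ℕ, ∃ N : ℕ, N₀ ≤ N ∧ (goodPrimes Δ' N).Nonempty ∧
      ∑ q ∈ goodPrimes Δ' N, offDiagMollified Δ' q ≤ U * ∑ q ∈ goodPrimes Δ' N, mainScaleReal Δ' q) :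
    ∀ N₁ : ℕ, ∃ N : ℕ, N₁ ≤ N ∧ ∃ S : Finset ℕ, S ⊆ goodPrimes Δ' N ∧ S.Nonempty ∧
      ∑ q ∈ S, offDiagMollified Δ' q ≤ U * ∑ q ∈ S, mainScaleReal Δ' q := by
  intro N₁
  obtain ⟨N, hN, hne, hbd⟩ := h N₁
  exact ⟨N, hN, goodPrimes Δ' N, Finset.Subset.refl _, hne, hbd⟩

/-! ### The entry of Ω″ with the window quantifiers: conclusion = the stub verbatim -/

/-- **Entry point of the alternative last mile Ω″: a sub-family bound on a window, beyond every threshold ⇒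
`stub_offDiagBelowSlack_io` VERBATIM.** For some `b > 1` and every `Δ′ ∈ (1, b)` a tolerance `U < 4(Δ′−1)/Δ′` and,
beyond every `N₁`, a scale `N` with a non-empty sub-family `S ⊆ goodPrimes Δ′ N` on which
`Σ_S offDiagMollified Δ′ q ≤ U·Σ_S mainScaleReal Δ′ q` — then OFF_io,U. Adapted from the sketch's
`stubOff_of_classBlockBound`. [cite: KowalskiMichelVanderKam2000, §6 p. 19 — derivation] -/
theorem offDiagBelowSlack_io_of_subfamilyBound
    (h : ∃ b₀ : ℝ, 1 < b₀ ∧ ∀ Δ' : ℝ, 1 < Δ' → Δ' < b₀ → ∃ U : ℝ, U < 4 * (Δ' - 1) / Δ' ∧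
      ∀ N₁ : ℕ, ∃ N : ℕ, N₁ ≤ N ∧ ∃ S : Finset ℕ, S ⊆ goodPrimes Δ' N ∧ S.Nonempty ∧
        ∑ q ∈ S, offDiagMollified Δ' q ≤ U * ∑ q ∈ S, mainScaleReal Δ' q) :
    ∃ b : ℝ, 1 < b ∧ ∀ Δ' : ℝ, 1 < Δ' → Δ' < b → ∃ U : ℝ, U < 4 * (Δ' - 1) / Δ' ∧
      ∀ q₀ : ℕ, ∃ q : ℕ, ∃ _ : NeZero q, q₀ ≤ q ∧ q.Prime ∧
        (∀ n : ℕ, (n : ℝ) ≠ KMV2000.qhat q ^ Δ') ∧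
          -(∑ l ∈ Icc 1 ⌊KMV2000.qhat q ^ Δ'⌋₊, ∑ m ∈ Icc 1 ⌊KMV2000.qhat q ^ Δ'⌋₊,
              ((KMV2000.mollifierCoeff (X ^ 2) (KMV2000.qhat q ^ Δ') l *
                  KMV2000.mollifierCoeff (X ^ 2) (KMV2000.qhat q ^ Δ') m : ℝ) : ℂ) *
                PeterssonSplit.offDiag q l m).re ≤
            U * KMV2000.mainScaleReal Δ' q := by
  obtain ⟨b₀, hb₀, h⟩ := h
  refine ⟨b₀, hb₀, fun Δ' h1 h2 ↦ ?_⟩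
  obtain ⟨U, hU, hN⟩ := h Δ' h1 h2
  exact ⟨U, hU, offDiag_io_of_subfamily_io hN⟩

/-- **The per-scale-predicate form of the entry** (e.g. `P_N q := χ̃_N(q) = ε_N`, the better `χ̃`-half of Ω″, or
`P_N := ⊤` at clean scales): conclusion = `stub_offDiagBelowSlack_io` verbatim.
[cite: KowalskiMichelVanderKam2000, §6 p. 19 — derivation] -/
theorem offDiagBelowSlack_io_of_filterBound
    (h : ∃ b₀ : ℝ, 1 < b₀ ∧ ∀ Δ' : ℝ, 1 < Δ' → Δ' < b₀ → ∃ U : ℝ, U < 4 * (Δ' - 1) / Δ' ∧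
      ∀ N₁ : ℕ, ∃ N : ℕ, N₁ ≤ N ∧ ∃ P : ℕ → Prop, ∃ _ : DecidablePred P,
        ((goodPrimes Δ' N).filter P).Nonempty ∧
          ∑ q ∈ (goodPrimes Δ' N).filter P, offDiagMollified Δ' q ≤
            U * ∑ q ∈ (goodPrimes Δ' N).filter P, mainScaleReal Δ' q) :
    ∃ b : ℝ, 1 < b ∧ ∀ Δ' : ℝ, 1 < Δ' → Δ' < b → ∃ U : ℝ, U < 4 * (Δ' - 1) / Δ' ∧
      ∀ q₀ : ℕ, ∃ q : ℕ, ∃ _ : NeZero q, q₀ ≤ q ∧ q.Prime ∧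
        (∀ n : ℕ, (n : ℝ) ≠ KMV2000.qhat q ^ Δ') ∧
          -(∑ l ∈ Icc 1 ⌊KMV2000.qhat q ^ Δ'⌋₊, ∑ m ∈ Icc 1 ⌊KMV2000.qhat q ^ Δ'⌋₊,
              ((KMV2000.mollifierCoeff (X ^ 2) (KMV2000.qhat q ^ Δ') l *
                  KMV2000.mollifierCoeff (X ^ 2) (KMV2000.qhat q ^ Δ') m : ℝ) : ℂ) *
                PeterssonSplit.offDiag q l m).re ≤
            U * KMV2000.mainScaleReal Δ' q := by
  obtain ⟨b₀, hb₀, h⟩ := h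
  refine ⟨b₀, hb₀, fun Δ' h1 h2 ↦ ?_⟩
  obtain ⟨U, hU, hN⟩ := h Δ' h1 h2
  exact ⟨U, hU, offDiag_io_of_filter_io hN⟩

/-! ### Better-of-two bookkeeping -/

/-- **Better of two parts.** If a finite family splits by a predicate and the ratio bound `Σ f ≤ U·Σ g` holds for the
whole family, it already holds on one of the two parts (else add the two strict inequalities). So a half bound is never
a weaker input to the entry than a block bound. [folklore] -/
theorem exists_half_sum_le {ι : Type*} (S : Finset ι) (p : ι → Prop) [DecidablePred p] (f g : ι → ℝ) (U : ℝ)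
    (h : ∑ i ∈ S, f i ≤ U * ∑ i ∈ S, g i) :
    ∑ i ∈ S.filter p, f i ≤ U * ∑ i ∈ S.filter p, g i ∨
      ∑ i ∈ S.filter (fun i ↦ ¬ p i), f i ≤ U * ∑ i ∈ S.filter (fun i ↦ ¬ p i), g i := by
  by_contra hcon
  simp only [not_or, not_le] at hcon
  obtain ⟨h1, h2⟩ := hcon
  rw [← Finset.sum_filter_add_sum_filter_not S p f, ← Finset.sum_filter_add_sum_filter_not S p g, mul_add] at h
  linarith

/-- **The «relativity» kernel of Ω″** (idea card, Lever): if the two halves carry the exceptional excess with opposite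
signs, `N₊ = e + s₊`, `N₋ = −e + s₋`, then the better half is controlled by the error terms alone —
`min (e + s₊) (−e + s₋) ≤ max s₊ s₋`, whatever the sign and the size of `e`. [folklore] -/
theorem min_add_le_max_of_antisymm (e s₁ s₂ : ℝ) : min (e + s₁) (-e + s₂) ≤ max s₁ s₂ := by
  rcases le_or_gt 0 e with he | he
  · exact (min_le_right _ _).trans (by linarith [le_max_right s₁ s₂])
  · exact (min_le_left _ _).trans (by linarith [le_max_left s₁ s₂])

/-- Averaged form of the relativity kernel: with masses `λ₊, λ₋ > 0` and half-sums `Σ₊ = λ₊(e + s₊)`, `Σ₋ = λ₋(−e + s₋)`,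
one of the halves has `Σ_± ≤ λ_± · max s₊ s₋`. [folklore] -/
theorem exists_half_le_mass_mul_max {e s₁ s₂ m₁ m₂ : ℝ} (hm₁ : 0 < m₁) (hm₂ : 0 < m₂) :
    m₁ * (e + s₁) ≤ m₁ * max s₁ s₂ ∨ m₂ * (-e + s₂) ≤ m₂ * max s₁ s₂ := by
  rcases le_or_gt 0 e with he | he
  · right
    exact mul_le_mul_of_nonneg_left (by linarith [le_max_right s₁ s₂]) hm₂.le
  · left
    exact mul_le_mul_of_nonneg_left (by linarith [le_max_left s₁ s₂]) hm₁.le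

end Summit.Parity.GeneralizedHardyLittlewood.Theorems.BeyondDiagonalBeatsQuarter.PeterssonSplit
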